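import Mathlib
import Summits.PneNP.PneNP.Theorems.ConvexRankGatesConvexGateBlindAffinePencilSwap
import Summits.PneNP.PneNP.Theorems.ConvexRankGatesConvexGateBlindAffinePencilCircle

/-!
# PneNP / ConvexRankGates — `ConvexGateBlind`: witnesses of excluded cliques for `2 × 2` pencils, parametrised on `(−1, 1]`

Helpers (`--supports stmt-PneNP-10680`), COLUMN-SPACE line (prover seat 2, session 26), PSD side; first half of the UPPER
BOUND on the exclusion number of valid `2 × 2` pencils (`…AffinePencilTwoBound.lean`, memo ANALYSIS-seat2-s26 §3.1).

* `pencil_isHermitian` — a pencil PSD on every `k`-clique-free graph (`k ≥ 3`) has symmetric `H₀` and `H_e` (validity at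
  the empty graph and at single edges), so `H(1_u)` is symmetric for every `u`;
* `exists_halfDir_witness` — hence an EXCLUDED clique (`H(1_{E(Q)}) ⋡ 0`) has a witness of the root-free form
  `y(u) = (u, √(1−u²))`, `u ∈ (−1, 1]` (scale a witness `y ≠ 0` to the closed upper half circle, `y ∼ −y`);
* `twoWit`, `twoWit_spec`, `twoWit_injOn` — a choice of such a parameter for every excluded `k`-set; distinct excluded
  cliques get distinct parameters (a direction refutes at most one clique, `pencil_direction_catches_one`);
* `pairForm_eq_circleAffine` — along `u`, the difference of the edge forms `y(u)ᵀ(H_e − H_{e'})y(u)` is an affine function of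
  the doubled point `P(u)` (`…AffinePencilCircle.lean`), positive at the parameter of an excluded clique containing `e` but
  not `e'` (`pairForm_pos_of_excluded`, the swap lemma). [new]
-/

set_option linter.dupNamespace false

namespace Summit.PneNP.PneNP.Theorems

open Finset Real Matrix Literature.Computability.Complexity
open Summit.PneNP.PneNP.Cruxes.ConvexGateBlind.StrictRankConicCover (Edge cdist)

noncomputable section

variable {m : ℕ}

/-- The pencil `H(1_u) = H₀ − Σ_{e ∈ u} H_e` of the tree's dual-affine PSD class, for `2 × 2` matrices. [folklore] -/
abbrev pen2 (H₀ : Matrix (Fin 2) (Fin 2) ℝ) (He : Edge m → Matrix (Fin 2) (Fin 2) ℝ) (u : Edge m → Bool) :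
    Matrix (Fin 2) (Fin 2) ℝ :=
  H₀ - ∑ e, if u e = true then He e else 0

/-! ## Symmetry from validity -/

/-- **A valid pencil is symmetric** (`k ≥ 3`): `H₀` and every `H_e` are Hermitian. [new] -/
theorem pencil_isHermitian {k : ℕ} (hk : 3 ≤ k) (H₀ : Matrix (Fin 2) (Fin 2) ℝ) (He : Edge m → Matrix (Fin 2) (Fin 2) ℝ)
    (hvalid : ∀ u : Edge m → Bool, cliqueFn m k u = false → (pen2 H₀ He u).PosSemidef) :
    H₀.IsHermitian ∧ ∀ e, (He e).IsHermitian := by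
  classical
  have h0 : H₀.IsHermitian := by
    have h := (hvalid (fun _ => false) (cliqueFn_empty_eq_false hk)).isHermitian
    simpa [pen2] using h
  refine ⟨h0, fun e => ?_⟩
  have h := (hvalid (fun f => decide (f = e)) (cliqueFn_single_eq_false hk e)).isHermitian
  have hsum : (∑ f, if (fun f => decide (f = e)) f = true then He f else 0) = He e := by
    rw [Finset.sum_eq_single e]
    · simp
    · intro f _ hfe; simp [hfe]
    · intro he; exact absurd (Finset.mem_univ e) he
  have h1 : (H₀ - He e).IsHermitian := by simpa [pen2, hsum] using h
  have : He e = H₀ - (H₀ - He e) := by abel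
  rw [this]
  exact h0.sub h1

/-- Every `H(1_u)` is Hermitian. [folklore] -/
theorem pen2_isHermitian {k : ℕ} (hk : 3 ≤ k) (H₀ : Matrix (Fin 2) (Fin 2) ℝ) (He : Edge m → Matrix (Fin 2) (Fin 2) ℝ)
    (hvalid : ∀ u : Edge m → Bool, cliqueFn m k u = false → (pen2 H₀ He u).PosSemidef) (u : Edge m → Bool) :
    (pen2 H₀ He u).IsHermitian := by
  classical
  obtain ⟨h0, h1⟩ := pencil_isHermitian hk H₀ He hvalid
  show (H₀ - ∑ e, if u e = true then He e else 0)ᴴ = H₀ - ∑ e, if u e = true then He e else 0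
  rw [conjTranspose_sub, conjTranspose_sum, h0.eq]
  congr 1
  refine Finset.sum_congr rfl fun e _ => ?_
  split_ifs
  · exact (h1 e).eq
  · exact conjTranspose_zero

/-! ## Witnesses on the half circle -/

/-- Scaling a vector scales the quadratic form by the square. [folklore] -/
theorem dotProduct_mulVec_smul_self (M : Matrix (Fin 2) (Fin 2) ℝ) (c : ℝ) (y : Fin 2 → ℝ) :
    (c • y) ⬝ᵥ (M *ᵥ (c • y)) = c ^ 2 * (y ⬝ᵥ (M *ᵥ y)) := by
  rw [Matrix.mulVec_smul, smul_dotProduct, dotProduct_smul, smul_eq_mul, smul_eq_mul]; ring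

/-- **A negative direction can be moved to the closed upper half circle**: if `yᵀMy < 0` then `y(u)ᵀ M y(u) < 0` for some
`u ∈ (−1, 1]`, `y(u) = (u, √(1−u²))`. [new] -/
theorem exists_halfDir_neg (M : Matrix (Fin 2) (Fin 2) ℝ) {y : Fin 2 → ℝ} (hy : y ⬝ᵥ (M *ᵥ y) < 0) :
    ∃ u ∈ Set.Ioc (-1 : ℝ) 1, halfDir u ⬝ᵥ (M *ᵥ halfDir u) < 0 := by
  -- `y ≠ 0`
  set r : ℝ := Real.sqrt (y 0 ^ 2 + y 1 ^ 2) with hr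
  have hy0 : y 0 ^ 2 + y 1 ^ 2 ≠ 0 := by
    intro h0
    have h00 : y 0 = 0 := by nlinarith [sq_nonneg (y 0), sq_nonneg (y 1)]
    have h11 : y 1 = 0 := by nlinarith [sq_nonneg (y 0), sq_nonneg (y 1)]
    have : y = 0 := by ext i; fin_cases i <;> simp [h00, h11]
    rw [this] at hy; simp at hy
  have hpos : 0 < y 0 ^ 2 + y 1 ^ 2 := lt_of_le_of_ne (by positivity) (Ne.symm hy0)
  have hrpos : 0 < r := Real.sqrt_pos.2 hpos
  have hr2 : r ^ 2 = y 0 ^ 2 + y 1 ^ 2 := Real.sq_sqrt hpos.le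
  -- the normalised vector `z = ± y / r` with `z 1 ≥ 0`
  rcases lt_trichotomy (y 1) 0 with h1 | h1 | h1
  · -- `y 1 < 0`: use `-y / r`
    refine ⟨-y 0 / r, ⟨?_, ?_⟩, ?_⟩
    · rw [lt_div_iff₀ hrpos]
      have : y 0 ^ 2 < r ^ 2 := by rw [hr2]; nlinarith
      nlinarith [sq_nonneg (y 0 + r), sq_abs (y 0)]
    · rw [div_le_one hrpos]
      have : y 0 ^ 2 < r ^ 2 := by rw [hr2]; nlinarith
      nlinarith [sq_nonneg (y 0 - r)]
    · have hsq : Real.sqrt (1 - (-y 0 / r) ^ 2) = -y 1 / r := by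
        have : 1 - (-y 0 / r) ^ 2 = (-y 1 / r) ^ 2 := by
          field_simp; nlinarith [hr2]
        rw [this, Real.sqrt_sq (div_nonneg (by linarith) hrpos.le)]
      have hdir : halfDir (-y 0 / r) = (-(1 / r)) • y := by
        ext i; fin_cases i
        · simp [halfDir]; ring
        · simp [halfDir, hsq]; ring
      rw [hdir, dotProduct_mulVec_smul_self]
      have : 0 < (-(1 / r)) ^ 2 := by rw [neg_sq]; positivity
      nlinarith
  · -- `y 1 = 0`: use `u = 1`
    refine ⟨1, ⟨by norm_num, le_rfl⟩, ?_⟩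
    have hy00 : y 0 ≠ 0 := by intro h; apply hy0; rw [h, h1]; ring
    have hdir : halfDir 1 = (1 / y 0) • y := by
      ext i; fin_cases i
      · simp [halfDir]; field_simp
      · simp [halfDir, h1]
    rw [hdir, dotProduct_mulVec_smul_self]
    have : 0 < (1 / y 0) ^ 2 := by positivity
    nlinarith
  · -- `y 1 > 0`: use `y / r`
    refine ⟨y 0 / r, ⟨?_, ?_⟩, ?_⟩
    · rw [lt_div_iff₀ hrpos]
      have : y 0 ^ 2 < r ^ 2 := by rw [hr2]; nlinarith
      nlinarith [sq_nonneg (y 0 - r)]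
    · rw [div_le_one hrpos]
      have : y 0 ^ 2 < r ^ 2 := by rw [hr2]; nlinarith
      nlinarith [sq_nonneg (y 0 + r)]
    · have hsq : Real.sqrt (1 - (y 0 / r) ^ 2) = y 1 / r := by
        have : 1 - (y 0 / r) ^ 2 = (y 1 / r) ^ 2 := by
          field_simp; nlinarith [hr2]
        rw [this, Real.sqrt_sq (div_nonneg h1.le hrpos.le)]
      have hdir : halfDir (y 0 / r) = (1 / r) • y := by
        ext i; fin_cases i
        · simp [halfDir]; ring
        · simp [halfDir, hsq]; ring
      rw [hdir, dotProduct_mulVec_smul_self]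
      have : 0 < (1 / r) ^ 2 := by positivity
      nlinarith

/-- **Excluded cliques have half-circle witnesses** (`k ≥ 3`, valid pencil). [new] -/
theorem exists_halfDir_witness {k : ℕ} (hk : 3 ≤ k) (H₀ : Matrix (Fin 2) (Fin 2) ℝ)
    (He : Edge m → Matrix (Fin 2) (Fin 2) ℝ)
    (hvalid : ∀ u : Edge m → Bool, cliqueFn m k u = false → (pen2 H₀ He u).PosSemidef)
    {u : Edge m → Bool} (hQ : ¬ (pen2 H₀ He u).PosSemidef) :
    ∃ t ∈ Set.Ioc (-1 : ℝ) 1, halfDir t ⬝ᵥ (pen2 H₀ He u *ᵥ halfDir t) < 0 := by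
  have hH := pen2_isHermitian hk H₀ He hvalid u
  have : ¬ ∀ y : Fin 2 → ℝ, 0 ≤ star y ⬝ᵥ (pen2 H₀ He u *ᵥ y) := fun h =>
    hQ (Matrix.PosSemidef.of_dotProduct_mulVec_nonneg hH h)
  push Not at this
  obtain ⟨y, hy⟩ := this
  rw [star_trivial] at hy
  exact exists_halfDir_neg _ hy

/-! ## The parameter of an excluded clique -/

open Classical in
/-- A half-circle parameter witnessing that the bare clique `Q` is excluded (`0` if it is not). [new] -/
def twoWit (H₀ : Matrix (Fin 2) (Fin 2) ℝ) (He : Edge m → Matrix (Fin 2) (Fin 2) ℝ) (Q : Finset (Fin m)) : ℝ :=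
  if h : ∃ t ∈ Set.Ioc (-1 : ℝ) 1, halfDir t ⬝ᵥ (pen2 H₀ He (cliqueVec Q) *ᵥ halfDir t) < 0 then Classical.choose h else 0

/-- The parameter of an excluded clique lies in `(−1, 1]` and its direction is negative. [new] -/
theorem twoWit_spec {k : ℕ} (hk : 3 ≤ k) (H₀ : Matrix (Fin 2) (Fin 2) ℝ) (He : Edge m → Matrix (Fin 2) (Fin 2) ℝ)
    (hvalid : ∀ u : Edge m → Bool, cliqueFn m k u = false → (pen2 H₀ He u).PosSemidef)
    {Q : Finset (Fin m)} (hQ : ¬ (pen2 H₀ He (cliqueVec Q)).PosSemidef) :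
    twoWit H₀ He Q ∈ Set.Ioc (-1 : ℝ) 1 ∧
      halfDir (twoWit H₀ He Q) ⬝ᵥ (pen2 H₀ He (cliqueVec Q) *ᵥ halfDir (twoWit H₀ He Q)) < 0 := by
  have h := exists_halfDir_witness hk H₀ He hvalid hQ
  rw [twoWit, dif_pos h]
  exact Classical.choose_spec h

/-- **Distinct excluded cliques have distinct parameters.** [new] -/
theorem twoWit_injOn {k : ℕ} (hk : 3 ≤ k) (H₀ : Matrix (Fin 2) (Fin 2) ℝ) (He : Edge m → Matrix (Fin 2) (Fin 2) ℝ)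
    (hvalid : ∀ u : Edge m → Bool, cliqueFn m k u = false → (pen2 H₀ He u).PosSemidef)
    {Q Q' : Finset (Fin m)} (hQk : Q.card = k) (hQ'k : Q'.card = k)
    (hQ : ¬ (pen2 H₀ He (cliqueVec Q)).PosSemidef) (hQ' : ¬ (pen2 H₀ He (cliqueVec Q')).PosSemidef)
    (h : twoWit H₀ He Q = twoWit H₀ He Q') : Q = Q' := by
  obtain ⟨-, h1⟩ := twoWit_spec hk H₀ He hvalid hQ
  obtain ⟨-, h2⟩ := twoWit_spec hk H₀ He hvalid hQ'
  rw [h] at h1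
  exact pencil_direction_catches_one hk H₀ He hvalid _ hQk hQ'k h1 h2

/-! ## The pair form -/

/-- The difference of two edge forms along the half circle, as an affine function of the doubled point. [new] -/
def pairForm (He : Edge m → Matrix (Fin 2) (Fin 2) ℝ) (e e' : Edge m) (t : ℝ) : ℝ :=
  circleAffine (((He e - He e') 0 0 + (He e - He e') 1 1) / 2) (((He e - He e') 0 0 - (He e - He e') 1 1) / 2)
    (((He e - He e') 0 1 + (He e - He e') 1 0) / 2) t

/-- `pairForm e e' t = y(t)ᵀH_e y(t) − y(t)ᵀH_{e'}y(t)` for `t² ≤ 1`. [folklore] -/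
theorem pairForm_eq (He : Edge m → Matrix (Fin 2) (Fin 2) ℝ) (e e' : Edge m) {t : ℝ} (ht : t ^ 2 ≤ 1) :
    pairForm He e e' t = halfDir t ⬝ᵥ (He e *ᵥ halfDir t) - halfDir t ⬝ᵥ (He e' *ᵥ halfDir t) := by
  rw [pairForm, circleAffine, ← quadForm_circleParam _ ht, Matrix.sub_mulVec, dotProduct_sub]

/-- **The pair form is positive at an excluded clique containing `e` but not `e'`** (swap lemma). [new] -/
theorem pairForm_pos_of_excluded {k : ℕ} (hk : 3 ≤ k) (H₀ : Matrix (Fin 2) (Fin 2) ℝ)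
    (He : Edge m → Matrix (Fin 2) (Fin 2) ℝ)
    (hvalid : ∀ u : Edge m → Bool, cliqueFn m k u = false → (pen2 H₀ He u).PosSemidef)
    {Q : Finset (Fin m)} (hQk : Q.card = k) (hQ : ¬ (pen2 H₀ He (cliqueVec Q)).PosSemidef)
    {e e' : Edge m} (he : cliqueVec Q e = true) (he' : cliqueVec Q e' = false) :
    0 < pairForm He e e' (twoWit H₀ He Q) := by
  obtain ⟨⟨h1, h2⟩, hneg⟩ := twoWit_spec hk H₀ He hvalid hQ
  have ht : twoWit H₀ He Q ^ 2 ≤ 1 := by nlinarith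
  rw [pairForm_eq He e e' ht]
  have := pencil_swap_lt hk H₀ He hvalid (halfDir (twoWit H₀ He Q)) hQk hneg he he'
  linarith

/-- **The pair form is negative at an excluded clique containing `e'` but not `e`.** [new] -/
theorem pairForm_neg_of_excluded {k : ℕ} (hk : 3 ≤ k) (H₀ : Matrix (Fin 2) (Fin 2) ℝ)
    (He : Edge m → Matrix (Fin 2) (Fin 2) ℝ)
    (hvalid : ∀ u : Edge m → Bool, cliqueFn m k u = false → (pen2 H₀ He u).PosSemidef)
    {Q : Finset (Fin m)} (hQk : Q.card = k) (hQ : ¬ (pen2 H₀ He (cliqueVec Q)).PosSemidef)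
    {e e' : Edge m} (he : cliqueVec Q e = false) (he' : cliqueVec Q e' = true) :
    pairForm He e e' (twoWit H₀ He Q) < 0 := by
  obtain ⟨⟨h1, h2⟩, hneg⟩ := twoWit_spec hk H₀ He hvalid hQ
  have ht : twoWit H₀ He Q ^ 2 ≤ 1 := by nlinarith
  rw [pairForm_eq He e e' ht]
  have := pencil_swap_lt hk H₀ He hvalid (halfDir (twoWit H₀ He Q)) hQk hneg he' he
  linarith

/-- **Half-circle witnesses** (registered form): for a `2 × 2` pencil PSD on every `k`-clique-free graph (`k ≥ 3`), every
excluded bare `k`-clique has a parameter `t ∈ (−1, 1]` whose direction `(t, √(1−t²))` is negative, and two excluded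
`k`-cliques with the same parameter coincide. [new] -/
theorem two_pencil_witnesses : ∀ {m k : ℕ}, 3 ≤ k → ∀ (H₀ : Matrix (Fin 2) (Fin 2) ℝ) (He : Edge m → Matrix (Fin 2) (Fin 2) ℝ), (∀ u : Edge m → Bool, cliqueFn m k u = false → (H₀ - ∑ e, if u e = true then He e else 0).PosSemidef) → ∀ (Q Q' : Finset (Fin m)), Q.card = k → Q'.card = k → ¬ (H₀ - ∑ e, if cliqueVec Q e = true then He e else 0).PosSemidef → ¬ (H₀ - ∑ e, if cliqueVec Q' e = true then He e else 0).PosSemidef → (twoWit H₀ He Q ∈ Set.Ioc (-1 : ℝ) 1) ∧ (twoWit H₀ He Q = twoWit H₀ He Q' → Q = Q') :=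
  fun hk H₀ He hvalid _ _ hQk hQ'k hQ hQ' =>
    ⟨(twoWit_spec hk H₀ He hvalid hQ).1, fun h => twoWit_injOn hk H₀ He hvalid hQk hQ'k hQ hQ' h⟩

end

end Summit.PneNP.PneNP.Theorems
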